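import Literature.AlgebraicGeometry.Frobenioids.PreFrobenioidMorphisms
import Mathlib.CategoryTheory.Widesubcategory
import Mathlib.CategoryTheory.Comma.Over.Basic
import HarnessLib

/-!
# Frobenioids I, Definition 1.3: Frobenioids (STEP-0 calibration fragment of the abc-iut cell)

Mochizuki, *The geometry of Frobenioids I: the general theory*, Kyushu J. Math. **62** (2008)
293–400, §1, Definition 1.3 and Remark 1.3.1, kurims text pp. 24–25
[cite: MochizukiFrdI2008, Def. 1.3].

A pre-Frobenioid `F : C → F_Φ` is a *Frobenioid* if it satisfies (i) surjectivity to the base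
category via pull-back morphisms (a)–(c), (ii) surjectivity to `N_{≥1}` via morphisms of Frobenius
type, (iii) surjectivity to the divisor monoid via co-angular morphisms (a)–(d), (iv) factorisation
of arbitrary morphisms, (v) factorisation of pre-steps, (vi) faithfulness up to units,
(vii) isotropic objects. We also prove the formal fact used to state (i)(c): pull-back morphisms
contain the identities and are closed under composition (so `C^pl-bk` is a wide subcategory).

Renderings (recorded for the referee). (i)(a) "every isomorphism class of `D` arises as the image of
an isomorphism class of a Frobenius-trivial object" ↦ every object of `D` is isomorphic to the base
of a Frobenius-trivial object. (i)(c) is stated with Mathlib's `WideSubcategory`/`Over`/`Over.post`.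
(iii)(c) "a uniquely determined bijection of monoids `O^▷(A) ≃ O^▷(B)` with `β ∘ φ = φ ∘ α`,
depending only on `Base(φ)`" ↦ existence of a `MulEquiv` with that property, plus: the `β` matched
to `α` depends only on `Base(φ)` (uniqueness itself is automatic since `φ` is an epimorphism).
(iii)(d) "the natural functors `^A(C^coa-pre) → Order(Φ(A))`, `(C^coa-pre)_A → Order(Φ(A))ᵒᵖ` are
equivalences" ↦ the four clauses full/essentially-surjective for the coslice and the slice (the
functors take values in a poset and `C` is totally epimorphic, so faithfulness is automatic and
"isomorphic in `Order(Φ(A))`" is equality for divisorial `Φ(A)`); this avoids presupposing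
(iii)(a) to build `C^coa-pre` as a category. (iv)(a), (v)(b)(c): "unique up to" ↦ any two
factorisations are related by isomorphisms as printed.
Deliberately NOT here: Remark 1.3.1 (`O^▷(A)` is commutative in a Frobenioid — a consequence,
proved in a later file), Propositions 1.4 ff. No statement of the paper is strengthened.
-/

namespace Literature.AlgebraicGeometry.Frobenioids

open CategoryTheory Opposite

universe w v v' u u'

namespace PreFrobenioid

variable {D : Type u} [Category.{v} D] {Φ : Dᵒᵖ ⥤ CommMonCat.{w}}
  {C : Type u'} [Category.{v'} C] (F : C ⥤ ElemFrobenioid Φ)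

/-! ### `C^pl-bk` is a wide subcategory (formal) -/

/-- Pull-back morphisms are closed under composition (pasting of the defining bijections).
[cite: MochizukiFrdI2008, Def. 1.2(ii)] -/
theorem IsPullbackMorphism.comp {X Y Z : C} {φ : X ⟶ Y} {ψ : Y ⟶ Z} (hφ : IsPullbackMorphism F φ)
    (hψ : IsPullbackMorphism F ψ) : IsPullbackMorphism F (φ ≫ ψ) := by
  intro W
  constructor
  · intro γ γ' h
    have h1 : γ ≫ φ ≫ ψ = γ' ≫ φ ≫ ψ := congrArg (fun p : PullbackHomData F (φ ≫ ψ) W => p.1.1) h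
    have h2 : Base F γ = Base F γ' := congrArg (fun p : PullbackHomData F (φ ≫ ψ) W => p.1.2) h
    have h3 : γ ≫ φ = γ' ≫ φ := by
      apply (hψ W).1
      apply Subtype.ext
      apply Prod.ext
      · show (γ ≫ φ) ≫ ψ = (γ' ≫ φ) ≫ ψ
        rw [Category.assoc, h1, Category.assoc]
      · show Base F (γ ≫ φ) = Base F (γ' ≫ φ)
        rw [base_comp, base_comp, h2]
    apply (hφ W).1
    exact Subtype.ext (Prod.ext h3 h2)
  · rintro ⟨⟨δ, ε⟩, hδ⟩
    dsimp only at hδ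
    obtain ⟨γ₁, hγ₁⟩ := (hψ W).2 ⟨(δ, ε ≫ Base F φ), by rw [hδ, base_comp, Category.assoc]⟩
    have hγ₁1 : γ₁ ≫ ψ = δ := congrArg (fun p : PullbackHomData F ψ W => p.1.1) hγ₁
    have hγ₁2 : Base F γ₁ = ε ≫ Base F φ := congrArg (fun p : PullbackHomData F ψ W => p.1.2) hγ₁
    obtain ⟨γ, hγ⟩ := (hφ W).2 ⟨(γ₁, ε), hγ₁2⟩
    have hγ1 : γ ≫ φ = γ₁ := congrArg (fun p : PullbackHomData F φ W => p.1.1) hγ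
    have hγ2 : Base F γ = ε := congrArg (fun p : PullbackHomData F φ W => p.1.2) hγ
    refine ⟨γ, Subtype.ext (Prod.ext ?_ hγ2)⟩
    show γ ≫ φ ≫ ψ = δ
    rw [← Category.assoc, hγ1, hγ₁1]

/-- `C^pl-bk` contains identities and is stable under composition. [cite: MochizukiFrdI2008, Def. 1.2(iv)] -/
instance pullbackMorphisms_isMultiplicative : (pullbackMorphisms F).IsMultiplicative where
  id_mem X := isPullbackMorphism_of_isIso F (𝟙 X)
  comp_mem _ _ hf hg := IsPullbackMorphism.comp F hf hg

/-- The category `C^pl-bk` of pull-back morphisms as a wide subcategory (FrdI Def. 1.2 (iv)).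
[cite: MochizukiFrdI2008, Def. 1.2(iv)] -/
abbrev PullbackCat : Type u' := WideSubcategory (pullbackMorphisms F)

/-- The functor `C^pl-bk_A := (C^pl-bk)_A → D_{A_D}` induced by the projection `C → D`
(FrdI Def. 1.3 (i)(c)). [cite: MochizukiFrdI2008, Def. 1.3(i)] -/
def pullbackSliceToBase (A : C) :
    Over (⟨A⟩ : PullbackCat F) ⥤
      Over ((wideSubcategoryInclusion (pullbackMorphisms F) ⋙ baseFunctor F).obj ⟨A⟩) :=
  Over.post (wideSubcategoryInclusion (pullbackMorphisms F) ⋙ baseFunctor F)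

/-! ### Auxiliary notions for (iii)(c), (iii)(d) -/

/-- A *co-angular pre-step* (the arrows of `C^coa-pre`, FrdI Def. 1.3 (iii)(d)).
[cite: MochizukiFrdI2008, Def. 1.3(iii)] -/
def IsCoAngularPreStep {A B : C} (φ : A ⟶ B) : Prop := IsCoAngular F φ ∧ IsPreStep F φ

/-- For a base-isomorphism `ψ : B → A`, the element `(ψ^*)⁻¹(Div ψ) ∈ Φ(A_D)` (FrdI Def. 1.3
(iii)(d): "since `ψ^* : Φ(A) ⥲ Φ(B)` is a bijection"); computed through `(Base ψ)⁻¹`.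
[cite: MochizukiFrdI2008, Def. 1.3(iii)] -/
noncomputable def invDiv {B A : C} (ψ : B ⟶ A) (h : IsBaseIso F ψ) : Φ.obj (op (baseObj F A)) :=
  haveI : IsIso (Base F ψ) := h
  pull Φ (inv (Base F ψ)) (Div F ψ)

variable {F} in
/-- `ψ^*((ψ^*)⁻¹(Div ψ)) = Div ψ`. [cite: MochizukiFrdI2008, Def. 1.3(iii)] -/
theorem pull_invDiv {B A : C} (ψ : B ⟶ A) (h : IsBaseIso F ψ) :
    pull Φ (Base F ψ) (invDiv F ψ h) = Div F ψ := by
  haveI : IsIso (Base F ψ) := h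
  unfold invDiv
  rw [← pull_comp, IsIso.hom_inv_id, pull_id]

/-! ### Definition 1.3 -/

/-- **Frobenioids** (FrdI Def. 1.3): a pre-Frobenioid `C → F_Φ` satisfying (i)–(vii) below.
[cite: MochizukiFrdI2008, Def. 1.3] -/
structure IsFrobenioid : Prop where
  /-- the standing hypotheses of Def. 1.2/1.3: a pre-Frobenioid -/
  isPreFrobenioid : IsPreFrobenioid Φ F
  /-- (i)(a) every isomorphism class of `D` is the image of (the class of) a Frobenius-trivial
  object -/
  i_a : ∀ A₀ : D, ∃ A : C, IsFrobeniusTrivial F A ∧ Nonempty (baseObj F A ≅ A₀)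
  /-- (i)(b) every base isomorphism `α : A_D ≅ B_D` is `Base(ψ) ∘ Base(φ)⁻¹` for pre-steps
  `φ : X → A`, `ψ : X → B` -/
  i_b : ∀ (A B : C) (α : baseObj F A ≅ baseObj F B), ∃ (X : C) (φ : X ⟶ A) (ψ : X ⟶ B),
    IsPreStep F φ ∧ IsPreStep F ψ ∧ Base F φ ≫ α.hom = Base F ψ
  /-- (i)(c) `C^pl-bk_A → D_{A_D}` is an equivalence for every `A` -/
  i_c : ∀ A : C, (pullbackSliceToBase F A).IsEquivalence
  /-- (ii) existence of morphisms of Frobenius type of every degree out of every object … -/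
  ii_exists : ∀ (A : C) (n : ℕ+), ∃ (B : C) (φ : A ⟶ B), IsFrobeniusType F φ ∧ degFr F φ = n
  /-- … and their essential uniqueness -/
  ii_unique : ∀ ⦃A B B' : C⦄ (φ : A ⟶ B) (ψ : A ⟶ B'), IsFrobeniusType F φ → IsFrobeniusType F ψ →
    degFr F φ = degFr F ψ → ∃ β : B ≅ B', φ ≫ β.hom = ψ
  /-- (iii)(a) co-angular morphisms are closed under composition -/
  iii_a : ∀ ⦃X Y Z : C⦄ (f : X ⟶ Y) (g : Y ⟶ Z), IsCoAngular F f → IsCoAngular F g →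
    IsCoAngular F (f ≫ g)
  /-- (iii)(b) if some `A' → A` is a co-angular pre-step then every `A' → A` is co-angular -/
  iii_b : ∀ ⦃A' A : C⦄ (φ : A' ⟶ A), IsCoAngularPreStep F φ → ∀ ψ : A' ⟶ A, IsCoAngular F ψ
  /-- (iii)(c) a co-angular pre-step `φ : A → B` induces `O^▷(A) ≃ O^▷(B)` with `β ∘ φ = φ ∘ α` … -/
  iii_c : ∀ ⦃A B : C⦄ (φ : A ⟶ B), IsCoAngularPreStep F φ →
    ∃ e : endSubmonoid F A ≃* endSubmonoid F B,
      ∀ α : endSubmonoid F A, φ ≫ (show B ⟶ B from (e α).1) = (show A ⟶ A from α.1) ≫ φ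
  /-- … which depends only on `Base(φ)` -/
  iii_c_base : ∀ ⦃A B : C⦄ (φ φ' : A ⟶ B), IsCoAngularPreStep F φ → IsCoAngularPreStep F φ' →
    Base F φ = Base F φ' → ∀ (α : endSubmonoid F A) (β β' : endSubmonoid F B),
      φ ≫ (show B ⟶ B from β.1) = (show A ⟶ A from α.1) ≫ φ →
      φ' ≫ (show B ⟶ B from β'.1) = (show A ⟶ A from α.1) ≫ φ' → β = β'
  /-- (iii)(d), coslice, full: `Div φ ≤ Div φ'` lifts to a co-angular pre-step under `A` -/
  iii_d_under_full : ∀ ⦃A B B' : C⦄ (φ : A ⟶ B) (φ' : A ⟶ B'), IsCoAngularPreStep F φ →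
    IsCoAngularPreStep F φ' → Div F φ ∣ Div F φ' →
      ∃ f : B ⟶ B', IsCoAngularPreStep F f ∧ φ ≫ f = φ'
  /-- (iii)(d), coslice, essentially surjective: every `x ∈ Φ(A)` is a `Div(φ)` -/
  iii_d_under_surj : ∀ (A : C) (x : Φ.obj (op (baseObj F A))), ∃ (B : C) (φ : A ⟶ B),
    IsCoAngularPreStep F φ ∧ Div F φ = x
  /-- (iii)(d), slice, full: `(ψ'^*)⁻¹ Div ψ' ≤ (ψ^*)⁻¹ Div ψ` lifts to a co-angular pre-step
  over `A` -/
  iii_d_over_full : ∀ ⦃A B B' : C⦄ (ψ : B ⟶ A) (ψ' : B' ⟶ A) (h : IsCoAngularPreStep F ψ)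
    (h' : IsCoAngularPreStep F ψ'), invDiv F ψ' h'.2.2 ∣ invDiv F ψ h.2.2 →
      ∃ g : B ⟶ B', IsCoAngularPreStep F g ∧ g ≫ ψ' = ψ
  /-- (iii)(d), slice, essentially surjective: every `x ∈ Φ(A)` is a `(ψ^*)⁻¹(Div ψ)` -/
  iii_d_over_surj : ∀ (A : C) (x : Φ.obj (op (baseObj F A))), ∃ (B : C) (ψ : B ⟶ A)
    (h : IsCoAngularPreStep F ψ), invDiv F ψ h.2.2 = x
  /-- (iv)(a) every morphism factors as pull-back ∘ pre-step ∘ Frobenius-type … -/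
  iv_a_exists : ∀ ⦃A B : C⦄ (φ : A ⟶ B), ∃ (X Y : C) (γ : A ⟶ X) (β : X ⟶ Y) (α : Y ⟶ B),
    γ ≫ β ≫ α = φ ∧ IsFrobeniusType F γ ∧ IsPreStep F β ∧ IsPullbackMorphism F α
  /-- … uniquely up to `(α ∘ δ, δ⁻¹ ∘ β ∘ ε, ε⁻¹ ∘ γ)` -/
  iv_a_unique : ∀ ⦃A B X Y X' Y' : C⦄ (φ : A ⟶ B) (γ : A ⟶ X) (β : X ⟶ Y) (α : Y ⟶ B)
    (γ' : A ⟶ X') (β' : X' ⟶ Y') (α' : Y' ⟶ B),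
    γ ≫ β ≫ α = φ → IsFrobeniusType F γ → IsPreStep F β → IsPullbackMorphism F α →
    γ' ≫ β' ≫ α' = φ → IsFrobeniusType F γ' → IsPreStep F β' → IsPullbackMorphism F α' →
      ∃ (ε : X ≅ X') (δ : Y ≅ Y'), γ ≫ ε.hom = γ' ∧ β ≫ δ.hom = ε.hom ≫ β' ∧ α = δ.hom ≫ α'
  /-- (iv)(b) every pull-back morphism is LB-invertible and linear -/
  iv_b : ∀ ⦃A B : C⦄ (φ : A ⟶ B), IsPullbackMorphism F φ → IsLBInvertible F φ ∧ IsLinear F φ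
  /-- (v)(a) pre-steps are monomorphisms -/
  v_a : ∀ ⦃A B : C⦄ (φ : A ⟶ B), IsPreStep F φ → Mono φ
  /-- (v)(b) pre-step = isometric pre-step ∘ co-angular pre-step … -/
  v_b_exists : ∀ ⦃A B : C⦄ (φ : A ⟶ B), IsPreStep F φ → ∃ (X : C) (β : A ⟶ X) (α : X ⟶ B),
    β ≫ α = φ ∧ IsCoAngularPreStep F β ∧ (IsIsometry F α ∧ IsPreStep F α)
  /-- … uniquely up to `(α ∘ γ, γ⁻¹ ∘ β)` -/
  v_b_unique : ∀ ⦃A B X X' : C⦄ (φ : A ⟶ B) (β : A ⟶ X) (α : X ⟶ B) (β' : A ⟶ X') (α' : X' ⟶ B),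
    β ≫ α = φ → IsCoAngularPreStep F β → (IsIsometry F α ∧ IsPreStep F α) →
    β' ≫ α' = φ → IsCoAngularPreStep F β' → (IsIsometry F α' ∧ IsPreStep F α') →
      ∃ γ : X ≅ X', β ≫ γ.hom = β' ∧ α = γ.hom ≫ α'
  /-- (v)(c) pre-step = co-angular pre-step ∘ isometric pre-step … -/
  v_c_exists : ∀ ⦃A B : C⦄ (φ : A ⟶ B), IsPreStep F φ → ∃ (X : C) (β' : A ⟶ X) (α' : X ⟶ B),
    β' ≫ α' = φ ∧ (IsIsometry F β' ∧ IsPreStep F β') ∧ IsCoAngularPreStep F α'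
  /-- … uniquely up to `(α' ∘ γ', γ'⁻¹ ∘ β')` -/
  v_c_unique : ∀ ⦃A B X X' : C⦄ (φ : A ⟶ B) (β : A ⟶ X) (α : X ⟶ B) (β' : A ⟶ X') (α' : X' ⟶ B),
    β ≫ α = φ → (IsIsometry F β ∧ IsPreStep F β) → IsCoAngularPreStep F α →
    β' ≫ α' = φ → (IsIsometry F β' ∧ IsPreStep F β') → IsCoAngularPreStep F α' →
      ∃ γ : X ≅ X', β ≫ γ.hom = β' ∧ α = γ.hom ≫ α'
  /-- (vi) base-equivalent, metrically equivalent co-angular pre-steps differ by a unit of `B` -/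
  vi : ∀ ⦃A B : C⦄ (φ ψ : A ⟶ B), IsCoAngularPreStep F φ → IsCoAngularPreStep F ψ →
    BaseEquivalent F φ ψ → MetricallyEquivalent F φ ψ →
      ∃ α ∈ unitsSubgroup F B, ψ ≫ α.hom = φ
  /-- (vii)(a) every object has an isotropic hull -/
  vii_a : ∀ A : C, ∃ (B : C) (φ : A ⟶ B), IsIsotropicHull F φ
  /-- (vii)(b) isotropy propagates along arrows -/
  vii_b : ∀ ⦃A B : C⦄ (_φ : A ⟶ B), IsIsotropic F A → IsIsotropic F B

end PreFrobenioid

end Literature.AlgebraicGeometry.Frobenioids
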